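import Summits.Ventures.PercRepro.GenQFlatLatticeN

/-!
# PercRepro — the flat-lattice counting rows, part O: the trace-size zero facts of `NRin` and `SPm`, `mvK`
(night-4, gen 12)

The emitter of the two-level profile LP sums (T5), (T7) and (T8) over every trace size `s ∈ 0 … n`; the LP sums
only over `q − 1 ≤ s ≤ min(n − 1, B)` (`B` the bound on the rank-`(q − 1)` flats).  The other terms vanish because
`flatsTr M G (q − 1) s` is empty there: `s < q − 1` (rank), `s = n` (the whole of `G` has rank `q`), `s > B` (the
flat bound) — for the inside counts `nrInM`, the classes `spSumM` and the moves `mvSumM`.  Imports `GenQFlatLatticeN`.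
-/
namespace PercRepro.Night4

open Finset ThmH SixFour GenQ PerFlat Star

variable {α : Type*} [DecidableEq α] {M : Matroid α} [M.Finite]

/-- A trace of fewer than `r` points spans no rank-`r` flat: `flatsTr M G r s = ∅` for `s < r`. -/
theorem flatsTr_eq_empty_of_lt_rank (G : Finset α) {r s : ℕ} (hsr : s < r) : flatsTr M G r s = ∅ := by
  rw [Finset.eq_empty_iff_forall_notMem]
  intro H hH
  have hH' := mem_flatsTr.1 hH
  have h1 : M.eRk ((H ∩ G : Finset α) : Set α) ≤ ((H ∩ G).card : ℕ∞) := by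
    have := M.eRk_le_encard ((H ∩ G : Finset α) : Set α)
    rwa [Set.encard_coe_eq_coe_finsetCard] at this
  rw [hH'.2.2, hH'.2.1] at h1
  have h2 : r ≤ s := by exact_mod_cast h1
  omega

/-- `NRin(s, r, s′) = 0` for a trace size `s < q − 1`. -/
theorem nrInM_eq_zero_of_trace_lt_rank (G : Finset α) {q s : ℕ} (hs : s < q - 1) (r s' : ℕ) :
    nrInM M G q s r s' = 0 := by
  unfold nrInM; rw [flatsTr_eq_empty_of_lt_rank G hs]; rfl

/-- `NRin(n, r, s′) = 0` when `G` has rank `q` (the whole of `G` is not a rank-`(q − 1)` trace). -/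
theorem nrInM_card_eq_zero {G : Finset α} {q : ℕ} (hrG : M.eRk (G : Set α) = (q : ℕ∞)) (hq : 1 ≤ q)
    (r s' : ℕ) : nrInM M G q G.card r s' = 0 := by
  unfold nrInM; rw [flatsTr_card_eq_empty hrG (by omega)]; rfl

/-- `NRin(s, r, s′) = 0` beyond the bound `B` on the rank-`(q − 1)` flats (`B < s`). -/
theorem nrInM_eq_zero_of_trace_flat_le {G : Finset α} {q B s : ℕ} (hflat : ∀ F ∈ flatsQ M (q - 1), F.card ≤ B)
    (hBs : B < s) (r s' : ℕ) : nrInM M G q s r s' = 0 := by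
  unfold nrInM; rw [flatsTr_eq_empty_of_flat_le hflat hBs]; rfl

/-- `mvK(s, k, m′, m) = 0` for `s < r`. -/
theorem mvSumM_eq_zero_of_lt_rank (G : Finset α) {r s : ℕ} (hsr : s < r) (k m' m : ℕ) :
    mvSumM M G r s k m' m = 0 := by
  unfold mvSumM; rw [flatsTr_eq_empty_of_lt_rank G hsr]; rfl

/-- `mvK(n, k, m′, m) = 0` when `G` has rank `q ≠ r`. -/
theorem mvSumM_card_eq_zero {G : Finset α} {q r : ℕ} (hrG : M.eRk (G : Set α) = (q : ℕ∞)) (hqr : q ≠ r)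
    (k m' m : ℕ) : mvSumM M G r G.card k m' m = 0 := by
  unfold mvSumM; rw [flatsTr_card_eq_empty hrG hqr]; rfl

/-- `mvK(s, k, m′, m) = 0` beyond the flat bound (`B < s`). -/
theorem mvSumM_eq_zero_of_flat_le {G : Finset α} {r B s : ℕ} (hflat : ∀ F ∈ flatsQ M r, F.card ≤ B)
    (hBs : B < s) (k m' m : ℕ) : mvSumM M G r s k m' m = 0 := by
  unfold mvSumM; rw [flatsTr_eq_empty_of_flat_le hflat hBs]; rfl

end PercRepro.Night4
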